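import Literature.AlgebraicGeometry.Deformation.SmoothLiftGluingSuppliersQuot
import Literature.AlgebraicGeometry.Deformation.SmoothLocalLiftNilpotent
import Literature.AlgebraicGeometry.Deformation.FlatDeformationChartTrivialisations
import Literature.AlgebraicGeometry.Morphisms.PrincipalAffineCoverBasicOpenRefinement
import HarnessLib

/-!
# A liftable principal affine cover of a smooth scheme over a nilpotent thickening ([Oort1971] Lemma (2.2.4); [Hartshorne2010] proof of
# Thm. 10.2 (a) «for each `i` let `U'_i` be an extension of `U_i`»)

Layer `Literature/AlgebraicGeometry/Deformation`, namespace `Literature.AlgebraicGeometry.Deformation.LiftableCoverQuot`.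
PROOF FILE, THEOREMS ONLY (no definition, no instance, no notation, no named fact, no `sorry`).  Sequel head (i) of the (U-glob) organ (cell
`hodgecm-mathlib`, P6 sub-desk P6b, LEAD «M-133» (b) «(i) GO»; count-neutral): the INPUT of ★ `SmoothLiftAtlasQuot` ∕ `SmoothLiftAtlasHingeQuot` —
local lifts `Pⱼ` (standard smooth over `A'`) with reductions `rⱼ : Pⱼ ↠ Γ(X₀, Vⱼ)`, `ker rⱼ = J Pⱼ`, on a PRINCIPAL affine cover — exists for every
`X₀ → Spec (A' ⧸ J)` smooth (`J` nilpotent) that carries SOME principal affine cover (e.g. projective over an affine base, ★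
`Morphisms/PrincipalAffineCoverOfProj`; the abelian consumer is projective over an Artinian base).

THE PRINT.  [Oort1971, Lemma (2.2.4), p. 274]: «For every `x ∈ X′` there exists an open neighbourhood `x ∈ U′ ⊂ X′` and a smooth morphism
`U → S = Spec (R)` such that `U ⊗_R R′ ≅ U′`» (★ R1 `StandardSmoothLift.exists_affineOpen_smooth_lift`, scheme form) — refined here to a
PRINCIPAL affine cover by basic opens of the liftable affines (★ `Morphisms/PrincipalAffineCoverBasicOpenRefinement`), which stay liftable
because a basic open of a liftable affine is liftable (localise the standard-smooth lift: Mathlib `IsStandardSmooth.localization_away` ∕ `.trans`,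
★ `LiftLocalizationQuot`).

* §1 ISO ↦ REDUCTION: R1's `(A'⧸J) ⊗_{A'} B ≃ₐ Γ` becomes `r : B →ₐ[A'] Γ` onto with `ker r = J B` (★ `ker_includeRight_of_surjective`,
  Mathlib `Algebra.TensorProduct.includeRight_surjective`).
* §2 A BASIC OPEN OF A LIFTABLE AFFINE IS LIFTABLE: localise the lift at a preimage of the function.
* §3 THE `A'`-STRUCTURE ON SECTIONS from `f₀ : X₀ → Spec (A'⧸J)` (`letI`, as ★ R1 writes it, composed with `A' → A'⧸J`) satisfies the
  compatibility `halg` of ★ `SmoothLiftAtlasQuot` (`Scheme.Hom.appLE_map`).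
* §4 **`exists_liftable_principal_affine_cover`** — for `f₀` smooth, `J` nilpotent and a principal affine cover `(U, b)` of `X₀`: a principal
  affine cover `V x ∋ x` (pointwise index, `V x ⊓ V y = D(c x y)`, `V x ≤ U (τ x)`) each member of which is the reduction of a STANDARD SMOOTH
  `A'`-algebra: `r x : B x →ₐ[A'] Γ(X₀, V x)` onto, `ker (r x) = J·(B x)`.
* §5 SMOOTHNESS OF THE LIFT (sequel head (vi), folded in): a scheme `X' → Spec A'` covered by affine opens whose section rings are (isomorphic to)
  STANDARD SMOOTH `A'`-algebras is smooth (Mathlib `HasRingHomProperty @Smooth RingHom.Smooth`, `of_iSup_eq_top`) — stated over an ABSTRACT `X'`,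
  so it lands before the gluing (iv) and is consumed after it ([Hartshorne2010] Thm. 10.2 (a) proof: «`X'` is flat over `A'` since each `U'_i` is»).

HC_CM is proved only modulo the printed citations until rung 0 closes; nothing here bears on a summit statement.

## References
* [Oort1971] F. Oort, *Finite group schemes, local moduli for abelian varieties, and lifting problems*, Compositio Math. 23 (1971),
  Lemma (2.2.4) (p. 274).
* [Hartshorne2010] R. Hartshorne, *Deformation Theory*, GTM 257, Springer (2010): Thm. 10.2 (a) and its proof (p. 81).
* [Hartshorne1977] R. Hartshorne, *Algebraic Geometry*, GTM 52 (1977), II Prop. 2.2, Ex. 2.16 (a).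
* [StacksProject] The Stacks Project, Tag 00T6 (standard smooth algebras), Tag 01V4 (smooth morphisms of schemes).
-/

noncomputable section

-- `TopCat.Presheaf`/`TopCat.Sheaf` are not reducible (as in Mathlib's `AlgebraicGeometry/Modules`).
set_option backward.isDefEq.respectTransparency false

open CategoryTheory AlgebraicGeometry Opposite TopologicalSpace
open scoped TensorProduct

universe u

namespace Literature.AlgebraicGeometry.Deformation.LiftableCoverQuot

open Literature.AlgebraicGeometry.Deformation.LiftLocalizationQuot Literature.AlgebraicGeometry.Deformation.StandardSmoothLift
  Literature.AlgebraicGeometry.Morphisms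

variable {A' : Type u} [CommRing A'] {J : Ideal A'}

/-! ## §1 From R1's tensor isomorphism to a reduction map -/

/-- **Iso ↦ reduction:** an `A'⧸J`-algebra isomorphism `e : (A'⧸J) ⊗_{A'} B ≃ₐ Q` (★ R1's output) yields the `A'`-algebra map
`r = e ∘ (b ↦ 1 ⊗ b) : B → Q`, ONTO with `ker r = J B` — the `(r, hr, hkr)` triple the ★ quotient-currency files consume.
[cite: Oort1971, Lemma (2.2.4) (p. 274)] [cite: StacksProject, Tag 00T6] -/
theorem exists_reduction_of_tensorEquiv {B : Type u} [CommRing B] [Algebra A' B] {Q : Type u} [CommRing Q]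
    [Algebra (A' ⧸ J) Q] [Algebra A' Q] [IsScalarTower A' (A' ⧸ J) Q] (e : (A' ⧸ J) ⊗[A'] B ≃ₐ[A' ⧸ J] Q) :
    ∃ r : B →ₐ[A'] Q, (∀ b, r b = e ((1 : A' ⧸ J) ⊗ₜ b)) ∧ Function.Surjective r ∧ RingHom.ker r = J.map (algebraMap A' B) := by
  let ι : B →ₐ[A'] (A' ⧸ J) ⊗[A'] B := Algebra.TensorProduct.includeRight
  let e' : (A' ⧸ J) ⊗[A'] B →ₐ[A'] Q := (e : (A' ⧸ J) ⊗[A'] B →ₐ[A' ⧸ J] Q).restrictScalars A'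
  refine ⟨e'.comp ι, fun b => rfl, ?_, ?_⟩
  · exact e.surjective.comp (Algebra.TensorProduct.includeRight_surjective B Ideal.Quotient.mk_surjective)
  · ext x
    have h1 : x ∈ RingHom.ker (e'.comp ι) ↔ ι x = 0 := by
      rw [RingHom.mem_ker, AlgHom.comp_apply]
      exact map_eq_zero_iff _ e.injective
    rw [h1, ← RingHom.mem_ker]
    change x ∈ RingHom.ker (Algebra.TensorProduct.includeRight (R := A') (A := A' ⧸ J) (B := B)).toRingHom ↔ _
    rw [ker_includeRight_of_surjective Ideal.Quotient.mk_surjective, Ideal.Quotient.algebraMap_eq, Ideal.mk_ker]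

/-! ## §2 A basic open of a liftable affine is liftable -/

/-- **Localising a lift:** if `r : B ↠ Q` has `ker r = J B` with `B` STANDARD SMOOTH over `A'`, and `Q'` is the localisation of `Q` away from
`g = r c`, then `Q'` is the reduction of the standard smooth `A'`-algebra `B[1/c]`: some `r' : Localization.Away c →ₐ[A'] Q'` is onto with
`ker r' = J B[1/c]` and `r' (b/1) = r(b)/1`. [cite: Oort1971, Lemma (2.2.4) (p. 274)] [cite: StacksProject, Tag 00T6] -/
theorem exists_localized_lift {B : Type u} [CommRing B] [Algebra A' B] [Algebra.IsStandardSmooth A' B]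
    {Q : Type u} [CommRing Q] [Algebra A' Q] (r : B →ₐ[A'] Q) (hr : Function.Surjective r)
    (hkr : RingHom.ker r = J.map (algebraMap A' B)) (c : B)
    {Q' : Type u} [CommRing Q'] [Algebra Q Q'] [Algebra A' Q'] [IsScalarTower A' Q Q'] [IsLocalization.Away (r c) Q'] :
    Algebra.IsStandardSmooth A' (Localization.Away c) ∧
      ∃ r' : Localization.Away c →ₐ[A'] Q', (∀ b, r' (algebraMap B (Localization.Away c) b) = algebraMap Q Q' (r b)) ∧
        Function.Surjective r' ∧ RingHom.ker r' = J.map (algebraMap A' (Localization.Away c)) := by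
  haveI : Algebra.IsStandardSmooth B (Localization.Away c) := Algebra.IsStandardSmooth.localization_away c
  obtain ⟨r', h'⟩ := exists_algHom_away (S := Localization.Away c) (B' := Q') r c
  exact ⟨Algebra.IsStandardSmooth.trans A' B (Localization.Away c), r', h', surjective_algHom_away r hr c r' h',
    ker_algHom_away J r hkr c r' h'⟩

/-! ## §3 The `A'`-algebra structures on sections coming from `f₀ : X₀ → Spec (A' ⧸ J)` are compatible with restriction -/

/-- The section rings of `X₀ → Spec (A'⧸J)` as `A'`-algebras (`A' → A'⧸J ≅ Γ(Spec) → Γ(X₀, ⊤) → Γ(X₀, W)`) are compatible with the restriction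
maps — the hypothesis `halg` of ★ `SmoothLiftAtlasQuot` for this family of structures (Mathlib `Scheme.Hom.appLE_map`).
[cite: Hartshorne2010, Thm. 10.2 (a) (proof), p. 81] -/
theorem halg_of_structureMorphism {X₀ : Scheme.{u}} (f₀ : X₀ ⟶ Spec (.of (A' ⧸ J))) (W V : X₀.Opens) (hle : V ≤ W) (a : A') :
    letI : Algebra A' Γ(X₀, W) :=
      (((Scheme.ΓSpecIso (.of (A' ⧸ J))).inv ≫ f₀.appLE ⊤ W le_top).hom.comp (Ideal.Quotient.mk J)).toAlgebra
    letI : Algebra A' Γ(X₀, V) :=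
      (((Scheme.ΓSpecIso (.of (A' ⧸ J))).inv ≫ f₀.appLE ⊤ V le_top).hom.comp (Ideal.Quotient.mk J)).toAlgebra
    X₀.presheaf.map (homOfLE hle).op (algebraMap A' Γ(X₀, W) a) = algebraMap A' Γ(X₀, V) a := by
  show (X₀.presheaf.map (homOfLE hle).op) (((Scheme.ΓSpecIso (.of (A' ⧸ J))).inv ≫ f₀.appLE ⊤ W le_top) (Ideal.Quotient.mk J a)) =
    ((Scheme.ΓSpecIso (.of (A' ⧸ J))).inv ≫ f₀.appLE ⊤ V le_top) (Ideal.Quotient.mk J a)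
  rw [← CommRingCat.comp_apply, Category.assoc, Scheme.Hom.appLE_map]

/-! ## §4 The liftable principal affine cover -/

/-- **A LIFTABLE PRINCIPAL AFFINE COVER** («for each `i` let `U'_i` be an extension of `U_i` over `C'`», made possible): let `J ⊆ A'` be nilpotent,
`f₀ : X₀ → Spec (A'⧸J)` smooth, and `(U, b)` a principal affine cover of `X₀` (`U j ∩ U l = D(b_{jl})`).  Then there is a principal affine cover
`V x ∋ x` (indexed by the points; `V x ⊓ V y = D(c x y)`, each `V x` inside a member of `U`) such that every `Γ(X₀, V x)` — as an `A'`-algebra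
through `f₀` — is the reduction of a STANDARD SMOOTH `A'`-algebra `B x`: `r x : B x →ₐ[A'] Γ(X₀, V x)` onto with `ker (r x) = J·(B x)`.
(★ R1 at every point, ★ common refinement by basic opens of the liftable affines, §2.) [cite: Oort1971, Lemma (2.2.4) (p. 274)]
[cite: Hartshorne2010, Thm. 10.2 (a) (proof), p. 81] [cite: Hartshorne1977, II Prop. 2.2 and Ex. 2.16 (a)] -/
theorem exists_liftable_principal_affine_cover (hJ : IsNilpotent J) {X₀ : Scheme.{u}} (f₀ : X₀ ⟶ Spec (.of (A' ⧸ J))) [Smooth f₀]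
    {ι : Type*} (U : ι → X₀.affineOpens) (b : (j l : ι) → Γ(X₀, (U j).1)) (hb : ∀ j l, (U j).1 ⊓ (U l).1 = X₀.basicOpen (b j l))
    (hU : ⨆ j, (U j).1 = ⊤) :
    ∃ (V : X₀ → X₀.affineOpens) (c : (x y : X₀) → Γ(X₀, (V x).1)) (τ : X₀ → ι),
      (∀ x, x ∈ (V x).1) ∧ (⨆ x, (V x).1 = ⊤) ∧ (∀ x y, (V x).1 ⊓ (V y).1 = X₀.basicOpen (c x y)) ∧ (∀ x, (V x).1 ≤ (U (τ x)).1) ∧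
      ∀ x, ∃ (B : Type u) (_ : CommRing B) (_ : Algebra A' B) (_ : Algebra.IsStandardSmooth A' B),
        letI : Algebra A' Γ(X₀, (V x).1) :=
          (((Scheme.ΓSpecIso (.of (A' ⧸ J))).inv ≫ f₀.appLE ⊤ (V x).1 le_top).hom.comp (Ideal.Quotient.mk J)).toAlgebra
        ∃ r : B →ₐ[A'] Γ(X₀, (V x).1), Function.Surjective r ∧ RingHom.ker r = J.map (algebraMap A' B) := by
  -- ★ R1 at every point: liftable affine neighbourhoods
  have hR1 := fun x : X₀ => exists_affineOpen_smooth_lift (A := A') hJ f₀ x ⊤ (Opens.mem_top x)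
  choose V' hV' hxV' _hle B' iB' aB' sB' e' using hR1
  -- refine the given principal cover by BASIC OPENS of the liftable affines (★ common refinement)
  have hU' : ⨆ x, (⟨V' x, hV' x⟩ : X₀.affineOpens).1 = ⊤ :=
    top_le_iff.mp fun x _ => Opens.mem_iSup.mpr ⟨x, hxV' x⟩
  obtain ⟨V, c, τ, τ', a, a', hxV, hVtop, hc, hVa, hVa'⟩ :=
    exists_principal_affine_cover_basicOpen_refinement₂ U b hb hU (fun x => ⟨V' x, hV' x⟩) hU'
  refine ⟨V, c, τ, hxV, hVtop, hc, fun x => (hVa x).le.trans (X₀.basicOpen_le _), fun x => ?_⟩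
  -- the member `V x = D(a' x)` is a basic open of the liftable affine `V' (τ' x)`
  set y := τ' x with hy
  letI algQ : Algebra (A' ⧸ J) Γ(X₀, V' y) :=
    ((Scheme.ΓSpecIso (.of (A' ⧸ J))).inv ≫ f₀.appLE ⊤ (V' y) le_top).hom.toAlgebra
  letI algQ' : Algebra A' Γ(X₀, V' y) :=
    (((Scheme.ΓSpecIso (.of (A' ⧸ J))).inv ≫ f₀.appLE ⊤ (V' y) le_top).hom.comp (Ideal.Quotient.mk J)).toAlgebra
  haveI : IsScalarTower A' (A' ⧸ J) Γ(X₀, V' y) := IsScalarTower.of_algebraMap_eq fun _ => rfl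
  letI := iB' y; letI := aB' y; haveI := sB' y
  obtain ⟨e⟩ := e' y
  obtain ⟨r, -, hr, hkr⟩ := exists_reduction_of_tensorEquiv (J := J) e
  -- `Γ(X₀, V x)` with its `A'`-structure, as an algebra over `Γ(X₀, V' y)` by restriction: a localisation away from `a' x`
  letI algV : Algebra A' Γ(X₀, (V x).1) :=
    (((Scheme.ΓSpecIso (.of (A' ⧸ J))).inv ≫ f₀.appLE ⊤ (V x).1 le_top).hom.comp (Ideal.Quotient.mk J)).toAlgebra
  have hle : (V x).1 ≤ V' y := (hVa' x).le.trans (X₀.basicOpen_le _)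
  letI algres : Algebra Γ(X₀, V' y) Γ(X₀, (V x).1) := (X₀.presheaf.map (homOfLE hle).op).hom.toAlgebra
  haveI : IsScalarTower A' Γ(X₀, V' y) Γ(X₀, (V x).1) :=
    IsScalarTower.of_algebraMap_eq fun a₀ => by
      rw [RingHom.algebraMap_toAlgebra]; exact (halg_of_structureMorphism f₀ (V' y) (V x).1 hle a₀).symm
  haveI hloc : IsLocalization.Away (a' x) Γ(X₀, (V x).1) := (hV' y).isLocalization_of_eq_basicOpen (a' x) (homOfLE hle) (hVa' x)
  -- localise the lift at a preimage of `a' x`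
  obtain ⟨c', hc'⟩ := hr (a' x)
  haveI : IsLocalization.Away (r c') Γ(X₀, (V x).1) := by rw [hc']; exact hloc
  obtain ⟨hss, r', -, hr', hkr'⟩ := exists_localized_lift (J := J) r hr hkr c' (Q' := Γ(X₀, (V x).1))
  exact ⟨Localization.Away c', inferInstance, inferInstance, hss, r', hr', hkr'⟩

/-! ## §5 Smoothness of a scheme covered by standard-smooth affine charts (sequel head (vi)) -/

/-- **Smoothness from standard-smooth charts:** if `g : X' → Spec A'` and `X'` is covered by affine opens `W j` whose section rings, as
`A'`-algebras through `g` (`A' ≅ Γ(Spec A') → Γ(X', ⊤) → Γ(X', W j)`), are STANDARD SMOOTH over `A'`, then `g` is smooth (hence flat, by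
Mathlib's `Smooth → Flat`). [cite: Hartshorne2010, Thm. 10.2 (a) (proof), p. 81] [cite: StacksProject, Tag 00T6] [cite: StacksProject, Tag 01V4] -/
theorem smooth_of_isStandardSmooth_cover {X' : Scheme.{u}} (g : X' ⟶ Spec (.of A')) {ι : Type*} (W : ι → X'.affineOpens)
    (hW : ⨆ j, (W j).1 = ⊤)
    (hss : ∀ j, letI : Algebra A' Γ(X', (W j).1) := ((Scheme.ΓSpecIso (.of A')).inv ≫ g.appLE ⊤ (W j).1 le_top).hom.toAlgebra
      Algebra.IsStandardSmooth A' Γ(X', (W j).1)) :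
    Smooth g := by
  refine HasRingHomProperty.of_iSup_eq_top (P := @Smooth) W hW fun j => ?_
  rw [← RingHom.Smooth.respectsIso.cancel_left_isIso (Scheme.ΓSpecIso (.of A')).inv, ← CommRingCat.hom_comp]
  letI : Algebra A' Γ(X', (W j).1) := ((Scheme.ΓSpecIso (.of A')).inv ≫ g.appLE ⊤ (W j).1 le_top).hom.toAlgebra
  haveI := hss j
  exact RingHom.smooth_algebraMap.mpr inferInstance

/-- The same with each chart ring ISOMORPHIC (over `A'`) to a standard smooth `A'`-algebra `P` — the shape the gluing (iv) delivers
(`P j ≃ₐ[A'] Γ(X', W j)`; Mathlib `Algebra.IsStandardSmooth.of_algEquiv`). [cite: Hartshorne2010, Thm. 10.2 (a) (proof), p. 81]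
[cite: StacksProject, Tag 01V4] -/
theorem smooth_of_cover_algEquiv_isStandardSmooth {X' : Scheme.{u}} (g : X' ⟶ Spec (.of A')) {ι : Type*} (W : ι → X'.affineOpens)
    (hW : ⨆ j, (W j).1 = ⊤)
    (hP : ∀ j, ∃ (P : Type u) (_ : CommRing P) (_ : Algebra A' P) (_ : Algebra.IsStandardSmooth A' P),
      letI : Algebra A' Γ(X', (W j).1) := ((Scheme.ΓSpecIso (.of A')).inv ≫ g.appLE ⊤ (W j).1 le_top).hom.toAlgebra
      Nonempty (P ≃ₐ[A'] Γ(X', (W j).1))) :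
    Smooth g := by
  refine smooth_of_isStandardSmooth_cover g W hW fun j => ?_
  letI : Algebra A' Γ(X', (W j).1) := ((Scheme.ΓSpecIso (.of A')).inv ≫ g.appLE ⊤ (W j).1 le_top).hom.toAlgebra
  obtain ⟨P, _, _, _, ⟨e⟩⟩ := hP j
  exact Algebra.IsStandardSmooth.of_algEquiv e

end Literature.AlgebraicGeometry.Deformation.LiftableCoverQuot

end
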